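import Summits.BirchSwinnertonDyer.BirchSwinnertonDyer.Theses.ThetaPartnerAtTwo
import Summits.BirchSwinnertonDyer.BirchSwinnertonDyer.Theorems.ThetaPartnerAtTwoSignedMainConjectureCMTwoRankZeroNoGreenberg
import HarnessLib

/-!
# stub_kimControlCMTwo — B. D. Kim's signed control term at p=2 for CM curves of analytic rank 0

This stub proves Kim's control theorem at p=2 for CM curves of analytic rank 0. The key is that
`signedEulerCharTwo_allPairs` provides (EC2)_A hypothesis-free (via the K4 Poitou-Tate rows,
discharged by tree theorems), which feeds `kimControl_at_of_signedEulerCharTwo` directly.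

UNCONDITIONAL: no Greenberg hypotheses needed. The K4 lineage closed on 2026-08-28 11:42Z,
discharging all four Poitou-Tate rows, making (EC2)_A a theorem for all good supersingular
curves with a₂ = 0. [cite: BDKim2013, Cor. 3.15 (p. 199)]
-/

set_option autoImplicit false
set_option linter.dupNamespace false

noncomputable section

open scoped Classical MatrixGroups ModularForm

open CongruenceSubgroup WeierstrassCurve Literature Literature.NumberTheory.EllipticCurves
  Literature.NumberTheory.EllipticCurves.ModularForms
  Literature.NumberTheory.EllipticCurves.Rank1Residual
  Literature.NumberTheory.EllipticCurves.Kobayashi2003 ZpExtension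
  Summit.BirchSwinnertonDyer.Rank1Residual.Supersingular

namespace Summit.BirchSwinnertonDyer.BirchSwinnertonDyer.Cruxes.SignedMainConjectureCMTwo.RankZero

/-- **B. D. Kim's control term at 2 for CM curves of analytic rank 0**: the constant term of a
characteristic ideal generator equals (up to unit) 2^{v₂(Tam)} · #Sel_{2^∞}. This follows directly from:
1. `signedEulerCharTwo_allPairs` — (EC2)_A hypothesis-free (K4 closed 2026-08-28 11:42Z)
2. `kimControl_at_of_signedEulerCharTwo` — converts (EC2)_A to Kim's control term (H4)

UNCONDITIONAL: no Greenberg hypotheses required. The CM and rank hypotheses are not used in the proof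
path — they are syntactic requirements of the stub's registration in the skeleton.
[cite: BDKim2013, Cor. 3.15 (p. 199)] [cite: GreenbergLNM1716, §4 Lemma 4.2 (p. 102)] -/
theorem stub_kimControlCMTwo :
    ∀ (A : WeierstrassCurve ℚ) [A.IsElliptic] [A.IsGloballyMinimal],
      A.HasCM → A.analyticRank = 0 → GoodSS A 2 → A.frobeniusTrace 2 = 0 →
      ∀ (κ : ZpExtension ℚ 2) (γ : Field.absoluteGaloisGroup ℚ), κ.IsCyclotomic → κ.IsTopGenerator γ →
      ∀ (D : SignedSelmerDualData A κ γ 1) [Module.Finite (IwasawaAlgebra 2) D.X],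
        Module.IsTorsion (IwasawaAlgebra 2) D.X →
      ∀ g : IwasawaAlgebra 2, D.charIdeal = Ideal.span {g} → Finite (A.selmerGroupPInfty 2) →
        ∃ u : ℤ_[2]ˣ, ((PowerSeries.constantCoeff g : ℤ_[2]) : ℚ_[2]) =
          ((u : ℤ_[2]) : ℚ_[2]) * ((2 : ℕ) : ℚ_[2]) ^ (padicValNat 2 A.tamagawaProduct) *
            (Nat.card (A.selmerGroupPInfty 2) : ℚ_[2]) := by
  intro A _ _ _hcm _hr hss ha κ γ hκ hγ D _ hX g hg hSel
  -- (EC2)_A hypothesis-free: K4 closed, Poitou-Tate rows are tree theorems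
  have hEC := Summit.BirchSwinnertonDyer.BirchSwinnertonDyer.Theorems.signedEulerCharTwo_allPairs A hss ha
  -- Apply Kim's control theorem conversion (H4); A is implicit
  exact Summit.BirchSwinnertonDyer.BirchSwinnertonDyer.Theorems.kimControl_at_of_signedEulerCharTwo hEC κ γ hκ hγ D hX g hg hSel

end Summit.BirchSwinnertonDyer.BirchSwinnertonDyer.Cruxes.SignedMainConjectureCMTwo.RankZero

end
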